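import Summits.HodgeConjecture.HodgeConjecture.Theorems.F0P3SmoothPartIsotypic        -- I♭ generic half (this seat, p812238)
import Summits.HodgeConjecture.HodgeConjecture.Theorems.F0P3TranslateDetection         -- ★ (p02 g3): `isUnitary_toContRep`
import Literature.NumberTheory.Automorphic.IrreducibleClassesConstituents              -- ★ (p04 g5): `IrrClass.nontrivial_of_isIrreducible`, constituent calculus
import Literature.NumberTheory.Automorphic.UnitaryGroupAdelicProduct                    -- ★ `archToAdelic_mul_finAdelicToAdelic`, `commute_archToAdelic_finAdelicToAdelic`
import Literature.NumberTheory.Automorphic.UnitaryGroupCohomologicalForms              -- ★ `finRep`, `HasFinComponent`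
import HarnessLib

/-!
# Crux `H413` — rung 3, brick I♭ (automorphic half): the FINITE PART of a discrete automorphic representation of `U(J)` is
# ISOTYPIC — the smooth part of `P|_{U(J)(𝔸_{F,f})}` is semisimple of type `σ` for every irreducible ADMISSIBLE `σ` occurring in `P`

Floor-0 programme P3 «U3-mult», seat F0P3-p03 (g5); crux item stmt-HodgeConjecture-24833 (`HCCMUnconditional.H413`); F0P3-plan (g3)
rulings (N6)/(R) 2026-08-31 (road I♭ → Σ♭ → T♭ for the in-house transfer T♭ in the smooth-part currency (b2′)).  PROOF lane: no `def`,
no `sorry`, no named fact; `--supports stmt-HodgeConjecture-24833`.  HONEST LABEL: HC_CM is proved only modulo the printed citations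
until rung 0 closes; this file discharges none of them.

THE INSTANCE of ★ `F0P3SmoothPartIsotypic.isotypicComponent_smoothPart_eq_top` (generic: unitary `π`, `β : B →* Γ`, compact open `K₀`,
irreducible admissible `σ` occurring through `f`, commuting operators `𝒯` with dense translates) at
`π := P.space.toContRep` (unitary, ★ `isUnitary_toContRep`), `β := finAdelicToAdelic` (so `π ∘ β = P.finRep` by `rfl`),
`K₀ := finAdelicIntegralLevel` (★ open, ★ compact), `𝒯 := {π(archToAdelic a)}` — these commute with `π(β ·)` (★
`commute_archToAdelic_finAdelicToAdelic`) and their translates of `f(W)` span a dense subspace: the closure of that span is a closed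
subspace invariant under every `g = (g_∞, 1)(1, g_f)` (★ `archToAdelic_mul_finAdelicToAdelic`), i.e. a closed subrepresentation of the
topologically IRREDUCIBLE `P` (`P.irreducible`), and it is non-zero.

* `finRep_eq` — `P.finRep = P.space.toContRep.toRepresentation ∘ finAdelicToAdelic` (`rfl`).
* `archOp_comm` — `π(archToAdelic a)` commutes with `π(finAdelicToAdelic b)`.
* `closure_iSup_range_archOp_comp_eq_top` — density of `Σ_a π(archToAdelic a) f(W)` for an equivariant `f ≠ 0`.
* HEAD **`isotypicComponent_finRep_smoothPart_eq_top`**: `σ` irreducible admissible, `P.HasFinComponent σ` ⇒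
  `isotypicComponent ℂ[U(J)(𝔸_{F,f})] (P.finRep^∞) σ = ⊤`; corollaries `isSemisimpleModule_finRep_smoothPart`, `isIsotypicOfType_finRep_smoothPart`
  — Flath's «`P_f ≅ ⊗′ P_v` is `σ`-isotypic» AS CONSUMED by the transfer T♭, proved in-house from one admissible occurrence.

References: D. Flath, PSPM 33.1 (1979) Thm. 3–4 [FlathCorvallis1979]; A. Borel, H. Jacquet, PSPM 33.1 (1979) §4.1, §4.6 [BorelJacquet1979];
I. N. Bernstein, A. V. Zelevinsky (1976) §2.1–2.3 [BernsteinZelevinsky1976]; N. Bourbaki, *Algèbre* VIII (2012) §4 [BourbakiAlgebreVIII2012].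
-/

set_option autoImplicit false
-- the mandated namespace repeats `HodgeConjecture.HodgeConjecture`, as in every `Theorems/*.lean` of this sub-problem
set_option linter.dupNamespace false

noncomputable section

open scoped InnerProductSpace MonoidAlgebra
open MeasureTheory NumberField IsDedekindDomain

namespace Summit.HodgeConjecture.HodgeConjecture.Cruxes.H413.F0P3FinPartIsotypic

open Literature.NumberTheory.Automorphic Literature.NumberTheory.Automorphic.UnitaryGroup
open Summit.HodgeConjecture.HodgeConjecture.Cruxes.H413.F0P3SmoothPartIsotypic
open Summit.HodgeConjecture.HodgeConjecture.Cruxes.H413.F0P3TranslateDetection (isUnitary_toContRep)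

variable {F E : Type} [Field F] [NumberField F] [Field E] [NumberField E] [Algebra F E] {c : E ≃ₐ[F] E} {N : ℕ}
  {J : Matrix (Fin N) (Fin N) E}
  {μ : Measure (adelicGroupData F E c N J).automorphicQuotient}
  [SMulInvariantMeasure (adelicGroupData F E c N J).Adelic (adelicGroupData F E c N J).automorphicQuotient μ]

/-! ## §1 The three hypotheses of the generic brick at the automorphic instance -/

/-- `P.finRep` IS `P.space.toContRep ∘ finAdelicToAdelic` (`rfl`). [cite: BorelJacquet1979, §4.6] -/
theorem finRep_eq (P : DiscreteAutomorphicRep (adelicGroupData F E c N J) μ) :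
    P.finRep = P.space.toContRep.toRepresentation.comp (finAdelicToAdelic F E c N J) := rfl

/-- **The archimedean operators commute with the finite-adelic ones** on `P.space` (★ `commute_archToAdelic_finAdelicToAdelic`).
[cite: BorelJacquet1979, §4.1] -/
theorem archOp_comm (P : DiscreteAutomorphicRep (adelicGroupData F E c N J) μ) (a : arch F E c N J) (b : finAdelic F E c N J)
    (y : ↥P.space.toSubmodule) :
    P.space.toContRep (archToAdelic F E c N J a) (P.space.toContRep (finAdelicToAdelic F E c N J b) y) =
      P.space.toContRep (finAdelicToAdelic F E c N J b) (P.space.toContRep (archToAdelic F E c N J a) y) := by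
  rw [← mul_apply_eq_comp, ← map_mul, (commute_archToAdelic_finAdelicToAdelic F E c N J a b).eq, map_mul,
    mul_apply_eq_comp]

/-- **Density of the archimedean translates.**  For an equivariant NON-ZERO `f : W → P.space` (along `finAdelicToAdelic`), the span of the
translates `π(archToAdelic a) f(W)` is DENSE in `P.space`: its closure is a closed subspace invariant under every `g = (g_∞, 1)·(1, g_f)` (★
`archToAdelic_mul_finAdelicToAdelic`), hence a closed subrepresentation of the topologically irreducible `P`, and it is non-zero.
[cite: BorelJacquet1979, §4.1, §4.6] -/
theorem closure_iSup_range_archOp_comp_eq_top (P : DiscreteAutomorphicRep (adelicGroupData F E c N J) μ)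
    {W : Type*} [AddCommGroup W] [Module ℂ W] (σ : Representation ℂ (finAdelic F E c N J) W)
    (f : W →ₗ[ℂ] ↥P.space.toSubmodule)
    (hf : ∀ (b : finAdelic F E c N J) (w : W), f (σ b w) = P.space.toContRep (finAdelicToAdelic F E c N J b) (f w))
    (hf0 : f ≠ 0) :
    (⨆ T ∈ Set.range (fun a : arch F E c N J => P.space.toContRep (archToAdelic F E c N J a)),
        LinearMap.range (T.toLinearMap ∘ₗ f)).topologicalClosure = ⊤ := by
  rw [iSup_range]
  set π := P.space.toContRep with hπdef
  set M : Submodule ℂ ↥P.space.toSubmodule :=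
    ⨆ a : arch F E c N J, LinearMap.range ((π (archToAdelic F E c N J a)).toLinearMap ∘ₗ f) with hMdef
  -- each translate `π(archToAdelic a) f(W)` lies in `M`
  have hgen : ∀ (a : arch F E c N J) (w : W), π (archToAdelic F E c N J a) (f w) ∈ M := fun a w => by
    have hle : LinearMap.range ((π (archToAdelic F E c N J a)).toLinearMap ∘ₗ f) ≤ M :=
      le_iSup (fun a : arch F E c N J => LinearMap.range ((π (archToAdelic F E c N J a)).toLinearMap ∘ₗ f)) a
    exact hle ⟨w, rfl⟩
  -- `M` is invariant under every `g = (g_∞, 1)(1, g_f) ∈ U(J)(𝔸_F)`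
  have hMinv : ∀ (g : (adelicGroupData F E c N J).Adelic) (y : ↥P.space.toSubmodule), y ∈ M → π g y ∈ M := by
    intro g y hy
    rw [← archToAdelic_mul_finAdelicToAdelic F E c N J g, map_mul, mul_apply_eq_comp]
    refine Submodule.iSup_induction (fun a : arch F E c N J => LinearMap.range ((π (archToAdelic F E c N J a)).toLinearMap ∘ₗ f))
      (motive := fun y => π (archToAdelic F E c N J (archPart F E c N J g))
        (π (finAdelicToAdelic F E c N J (finPart F E c N J g)) y) ∈ M) hy ?_ ?_ ?_
    · rintro a' _ ⟨w, rfl⟩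
      change π (archToAdelic F E c N J (archPart F E c N J g))
        (π (finAdelicToAdelic F E c N J (finPart F E c N J g)) (π (archToAdelic F E c N J a') (f w))) ∈ M
      rw [← archOp_comm P a' (finPart F E c N J g) (f w), ← hf, ← mul_apply_eq_comp, ← map_mul, ← map_mul]
      exact hgen _ _
    · rw [map_zero, map_zero]
      exact M.zero_mem
    · intro y z hy hz
      rw [map_add, map_add]
      exact M.add_mem hy hz
  -- the closure of `M` as a closed subrepresentation of `P`
  have hCinv : ∀ (g : (adelicGroupData F E c N J).Adelic) (y : ↥P.space.toSubmodule), y ∈ M.topologicalClosure →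
      π g y ∈ M.topologicalClosure := fun g y hy => by
    have hsub : (π g : ↥P.space.toSubmodule → ↥P.space.toSubmodule) '' (M : Set ↥P.space.toSubmodule) ⊆ (M : Set ↥P.space.toSubmodule) := by
      rintro _ ⟨z, hz, rfl⟩
      exact hMinv g z hz
    have hy' : y ∈ closure (M : Set ↥P.space.toSubmodule) := by rwa [← Submodule.topologicalClosure_coe]
    have h1 : π g y ∈ closure ((π g : ↥P.space.toSubmodule → ↥P.space.toSubmodule) '' (M : Set ↥P.space.toSubmodule)) :=
      image_closure_subset_closure_image (π g).continuous ⟨y, hy', rfl⟩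
    have h2 := closure_mono hsub h1
    rwa [← Submodule.topologicalClosure_coe] at h2
  let C : ContRepresentation.ClosedSubrep π :=
    { toSubmodule := M.topologicalClosure
      apply_mem_toSubmodule := fun g y hy => hCinv g y hy
      isClosed' := Submodule.isClosed_topologicalClosure _ }
  have hCsub : C.toSubmodule = M.topologicalClosure := rfl
  -- `C ≠ ⊥` (it contains `f w ≠ 0`), hence `C = ⊤` by irreducibility
  obtain ⟨w, hw⟩ : ∃ w : W, f w ≠ 0 := by
    by_contra h
    push Not at h
    exact hf0 (LinearMap.ext h)
  have hfw : f w ∈ C.toSubmodule := by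
    rw [hCsub]
    refine M.le_topologicalClosure ?_
    have h1 := hgen 1 w
    rwa [map_one, map_one, one_apply_eq_self] at h1
  haveI : IsSimpleOrder (ContRepresentation.ClosedSubrep π) := P.irreducible
  rcases eq_bot_or_eq_top C with hC | hC
  · exfalso
    apply hw
    have : f w ∈ (⊥ : ContRepresentation.ClosedSubrep π).toSubmodule := hC ▸ hfw
    rwa [ContRepresentation.ClosedSubrep.toSubmodule_bot, Submodule.mem_bot] at this
  · rw [← hCsub, hC, ContRepresentation.ClosedSubrep.toSubmodule_top]

/-! ## §2 HEAD: the finite part of `P` is `σ`-isotypic -/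

/-- **An occurrence as a plain equivariant non-zero linear map.**  `P.HasFinComponent σ` (an injective intertwiner `σ → P.finRep`) for an
irreducible `σ` yields `f : W →ₗ P.space`, equivariant along `finAdelicToAdelic` and non-zero. [cite: BorelJacquet1979, §4.6] -/
theorem exists_equivariant_ne_zero_of_hasFinComponent (P : DiscreteAutomorphicRep (adelicGroupData F E c N J) μ)
    {W : Type} [AddCommGroup W] [Module ℂ W] (σ : Representation ℂ (finAdelic F E c N J) W)
    (hirr : σ.IsIrreducible) (hP : P.HasFinComponent σ) :
    ∃ f : W →ₗ[ℂ] ↥P.space.toSubmodule,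
      (∀ (b : finAdelic F E c N J) (w : W), f (σ b w) = P.space.toContRep (finAdelicToAdelic F E c N J b) (f w)) ∧
        Function.Injective f ∧ f ≠ 0 := by
  obtain ⟨fI, hfinj⟩ := hP
  haveI : Nontrivial W := IrrClass.nontrivial_of_isIrreducible σ
  refine ⟨fI.toLinearMap, fun b w => Representation.IntertwiningMap.isIntertwining σ P.finRep fI b w, hfinj, fun h0 => ?_⟩
  obtain ⟨w, hw⟩ := exists_ne (0 : W)
  apply hw
  apply hfinj
  change fI.toLinearMap w = fI.toLinearMap 0
  rw [h0, LinearMap.zero_apply, LinearMap.zero_apply]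

/-- The archimedean operators commute with `P.finRep`, in the shape consumed by ★ `F0P3SmoothPartIsotypic`. [cite: BorelJacquet1979, §4.1] -/
theorem archOps_comm (P : DiscreteAutomorphicRep (adelicGroupData F E c N J) μ) :
    ∀ T ∈ Set.range (fun a : arch F E c N J => P.space.toContRep (archToAdelic F E c N J a)),
      ∀ (b : finAdelic F E c N J) (y : ↥P.space.toSubmodule),
        T (P.space.toContRep (finAdelicToAdelic F E c N J b) y) = P.space.toContRep (finAdelicToAdelic F E c N J b) (T y) := by
  rintro _ ⟨a, rfl⟩ b y
  exact archOp_comm P a b y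

/-- **HEAD — the smooth part of `P|_{U(J)(𝔸_{F,f})}` is `σ`-ISOTYPIC**: for a discrete automorphic `P` of `U(J)` and an irreducible ADMISSIBLE
`σ` occurring in `P` (★ `HasFinComponent`), `isotypicComponent ℂ[U(J)(𝔸_{F,f})] (P.finRep^∞) σ = ⊤` — the generic ★
`isotypicComponent_smoothPart_eq_top` at `(P.space.toContRep, finAdelicToAdelic, finAdelicIntegralLevel, {π(archToAdelic a)})`.
[cite: FlathCorvallis1979, Thm. 3] [cite: BorelJacquet1979, §4.6] [cite: BourbakiAlgebreVIII2012, VIII §4 n°1–2] -/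
theorem isotypicComponent_finRep_smoothPart_eq_top (P : DiscreteAutomorphicRep (adelicGroupData F E c N J) μ)
    {W : Type} [AddCommGroup W] [Module ℂ W] (σ : Representation ℂ (finAdelic F E c N J) W)
    (hirr : σ.IsIrreducible) (hadm : σ.IsAdmissible) (hP : P.HasFinComponent σ) :
    isotypicComponent ℂ[finAdelic F E c N J] ((Representation.smoothPart P.finRep).toRepresentation).asModule σ.asModule = ⊤ := by
  obtain ⟨f, hf, -, hf0⟩ := exists_equivariant_ne_zero_of_hasFinComponent P σ hirr hP
  exact isotypicComponent_smoothPart_eq_top P.space.toContRep (isUnitary_toContRep P) (finAdelicToAdelic F E c N J)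
    (isOpen_finAdelicIntegralLevel F E c N J) (isCompact_finAdelicIntegralLevel F E c N J) σ hadm f hf
    (Set.range fun a : arch F E c N J => P.space.toContRep (archToAdelic F E c N J a)) (archOps_comm P)
    (closure_iSup_range_archOp_comp_eq_top P σ f hf hf0)

/-- Corollary: the smooth part of `P|_{U(J)(𝔸_{F,f})}` is a SEMISIMPLE `ℂ[U(J)(𝔸_{F,f})]`-module. [cite: FlathCorvallis1979, Thm. 3]
[cite: BourbakiAlgebreVIII2012, VIII §4 n°1 Prop. 2] -/
theorem isSemisimpleModule_finRep_smoothPart (P : DiscreteAutomorphicRep (adelicGroupData F E c N J) μ)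
    {W : Type} [AddCommGroup W] [Module ℂ W] (σ : Representation ℂ (finAdelic F E c N J) W)
    (hirr : σ.IsIrreducible) (hadm : σ.IsAdmissible) (hP : P.HasFinComponent σ) :
    IsSemisimpleModule ℂ[finAdelic F E c N J] ((Representation.smoothPart P.finRep).toRepresentation).asModule := by
  obtain ⟨f, hf, -, hf0⟩ := exists_equivariant_ne_zero_of_hasFinComponent P σ hirr hP
  exact isSemisimpleModule_smoothPart P.space.toContRep (isUnitary_toContRep P) (finAdelicToAdelic F E c N J)
    (isOpen_finAdelicIntegralLevel F E c N J) (isCompact_finAdelicIntegralLevel F E c N J) σ hadm f hf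
    (Set.range fun a : arch F E c N J => P.space.toContRep (archToAdelic F E c N J a)) (archOps_comm P)
    (closure_iSup_range_archOp_comp_eq_top P σ f hf hf0)

/-- Corollary: the smooth part of `P|_{U(J)(𝔸_{F,f})}` is ISOTYPIC OF TYPE `σ` — every simple `ℂ[U(J)(𝔸_{F,f})]`-submodule is isomorphic to
`σ`; in particular the irreducible admissible finite component of `P` is unique up to isomorphism. [cite: FlathCorvallis1979, Thm. 3]
[cite: BourbakiAlgebreVIII2012, VIII §4 n°1 Prop. 2] -/
theorem isIsotypicOfType_finRep_smoothPart (P : DiscreteAutomorphicRep (adelicGroupData F E c N J) μ)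
    {W : Type} [AddCommGroup W] [Module ℂ W] (σ : Representation ℂ (finAdelic F E c N J) W)
    (hirr : σ.IsIrreducible) (hadm : σ.IsAdmissible) (hP : P.HasFinComponent σ) :
    IsIsotypicOfType ℂ[finAdelic F E c N J] ((Representation.smoothPart P.finRep).toRepresentation).asModule σ.asModule := by
  obtain ⟨f, hf, -, hf0⟩ := exists_equivariant_ne_zero_of_hasFinComponent P σ hirr hP
  exact isIsotypicOfType_smoothPart P.space.toContRep (isUnitary_toContRep P) (finAdelicToAdelic F E c N J)
    (isOpen_finAdelicIntegralLevel F E c N J) (isCompact_finAdelicIntegralLevel F E c N J) σ hadm f hf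
    (Set.range fun a : arch F E c N J => P.space.toContRep (archToAdelic F E c N J a)) (archOps_comm P)
    (closure_iSup_range_archOp_comp_eq_top P σ f hf hf0)

end Summit.HodgeConjecture.HodgeConjecture.Cruxes.H413.F0P3FinPartIsotypic

end
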